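import Summits.AtomisticToContinuum.BoseEinsteinCondensation.Theses.BECZeroCrossingDilute
import Literature.MathematicalPhysics.QuantumLattice.SpinChargeKinematics
import Literature.MathematicalPhysics.QuantumLattice.LiebMattisSectorPF
import Literature.MathematicalPhysics.QuantumLattice.SpinChainsAkltCorrelationProofs
import Literature.MathematicalPhysics.QuantumLattice.SpinChainsSpinSystemProofs
import Summits.AtomisticToContinuum.BoseEinsteinCondensation.Theorems.InsertionFieldDelocalisation.Negative.PerronExistence
import HarnessLib

/-!
# The planar-deficit identity for spin ½ on the torus `(ℤ/Lℤ)³`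
# (stub `stub_planarDeficit`, line `birth`, crux `NearIsotropicDiluteBEC` = stmt-AtomisticToContinuum-13905,
# route BECZeroCrossingDilute, sub-problem BoseEinsteinCondensation)

**Statement.** Let `V = L³` be the number of sites of the torus `TorusSite 3 L`, let
`Q = (S¹_tot)² + (S²_tot)²` be the planar part of the total-spin Casimir of the spin-`½` system
(`totalSpin 1 0`, `totalSpin 1 1`), and let `ψ` be a unit vector in the magnetisation sector
`S³_tot ψ = (N - V/2) ψ` (hypothesis `(totalSpin 1 2 + (V/2 - N)·1) ψ = 0`). Then
`Re⟨ψ, Qψ⟩ + N - V/2 = N(V - N + 1) - ½ Σ_{x,y} Re⟨ψ, (1 - T_xy)ψ⟩`, the double sum running over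
ORDERED pairs of sites and `T_xy = permOp (Equiv.swap x y)` being the transposition of the spins at
`x` and `y` (`T_xx = 1`). Pure spin-`½` algebra: no Hamiltonian, no ground state; the hypotheses
`2 ≤ L`, `N ≤ L³` of the registered signature are not used.

**Proof.** (i) Dirac's exchange identity `T_xy = 2 𝐒_x·𝐒_y + ½` for `x ≠ y`
(`nidB1_permOp_swap_eq`), proved entrywise in the product basis from `permOp_apply` and the entries
`spinDot_apply_of_ne` of `𝐒_x·𝐒_y = ½(S⁺_xS⁻_y + S⁻_xS⁺_y) + SᶻₓSᶻ_y`, by the sixteen-case check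
`nidB1_fin_two_exchange` on `ℂ² ⊗ ℂ²`. (ii) `𝐒_x·𝐒_x = ¾` (spin-`½` Casimir,
`sum_siteSpin_mul_siteSpin_holds`) and `T_xx = 1`, so `T_xy + [x = y] = 2 𝐒_x·𝐒_y + ½` for all
`x, y` (`nidB1_permOp_swap_add_ite`). (iii) `(𝐒_tot)² = Σ_x Σ_y 𝐒_x·𝐒_y`
(`nidB1_totalSpinSq_eq_sum_spinDot`), whence the operator identity
`Σ_x Σ_y T_xy + V·1 = 2(𝐒_tot)² + (V²/2)·1` (`nidB1_sum_permOp_swap`). (iv) Take the expectation in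
`ψ`: `Q = (𝐒_tot)² - (S³_tot)²`, `⟨ψ, (S³_tot)²ψ⟩ = M²` with `M = N - V/2`, `⟨ψ, T_xyψ⟩ =
1 - ⟨ψ, (1 - T_xy)ψ⟩`, and `V²/4 + V/2 - M² + M = N(V - N + 1)`.

**Sources.** P. A. M. Dirac, *The Principles of Quantum Mechanics* (4th ed.), §58 (permutations as
functions of the spins, `P_xy = ½(1 + σ_x·σ_y)`); H. Tasaki, *Physics and Mathematics of Quantum
Many-Body Systems* (Springer, 2020), §2.1 eq. (2.1.2), §2.2 eqs. (2.2.7)–(2.2.13), §2.4 eq. (2.4.1).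
All statements are finite-dimensional matrix algebra. [folklore]
-/

noncomputable section

namespace Summit.AtomisticToContinuum.BoseEinsteinCondensation.Cruxes.NearIsotropicDiluteBEC.Birth

open scoped BigOperators Matrix ComplexOrder
open Literature.MathematicalPhysics.QuantumLattice Literature.Probability.LatticeModels Matrix Complex Finset

/-! ### Dirac's exchange identity `T_xy = 2 𝐒_x·𝐒_y + ½` -/

/-- The exchange identity on `ℂ² ⊗ ℂ²`, entrywise: for basis labels `a, b` (row) and `c, d` (column)
of the two tensor factors, `[c = b ∧ d = a] = 2(½(S⁺_{ac}S⁻_{bd} + S⁻_{ac}S⁺_{bd}) + Sᶻ_{ac}Sᶻ_{bd}) + ½[a = c ∧ b = d]`,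
i.e. `SWAP = 2 𝐒 ⊗ 𝐒 + ½` for two spins `½` (sixteen cases). Dirac, *Principles* §58;
Tasaki (2020) §2.1. [folklore] -/
theorem nidB1_fin_two_exchange (a b c d : Fin 2) :
    (if c = b ∧ d = a then (1 : ℂ) else 0) =
      2 * (1 / 2 * (spinRaise 1 a c * spinLower 1 b d + spinLower 1 a c * spinRaise 1 b d) +
          SpinOperators.spinZ 1 a c * SpinOperators.spinZ 1 b d) +
        1 / 2 * (if a = c ∧ b = d then 1 else 0) := by
  fin_cases a <;> fin_cases b <;> fin_cases c <;> fin_cases d <;>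
    norm_num [spinRaise_apply, spinLower_eq_conjTranspose, conjTranspose_apply, spinZ_apply]

/-- **Dirac's exchange identity** for spin `½`: the transposition of the spins at two distinct
sites is `T_xy = permOp (Equiv.swap x y) = 2 𝐒_x·𝐒_y + ½·1`. Proved entrywise in the product
basis (`permOp_apply`, `spinDot_apply_of_ne`, `nidB1_fin_two_exchange`). Dirac, *Principles* §58;
Tasaki (2020) §2.4, eq. (2.4.1). [folklore] -/
theorem nidB1_permOp_swap_eq {Λ : Type*} [Fintype Λ] [DecidableEq Λ] {x y : Λ} (hxy : x ≠ y) :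
    (permOp (Equiv.swap x y) : Op Λ 2) = (2 : ℂ) • spinDot 1 x y + (1 / 2 : ℂ) • 1 := by
  ext σ τ
  rw [permOp_apply, Matrix.add_apply, Matrix.smul_apply, Matrix.smul_apply, smul_eq_mul,
    smul_eq_mul, spinDot_apply_of_ne 1 hxy σ τ, Matrix.one_apply]
  by_cases h : ∀ z, z ≠ x → z ≠ y → σ z = τ z
  · rw [if_pos h]
    have h1 : (τ = fun z => σ (Equiv.swap x y z)) ↔ (τ x = σ y ∧ τ y = σ x) := by
      constructor
      · intro hτ
        have hx := congrFun hτ x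
        have hy := congrFun hτ y
        simp only [Equiv.swap_apply_left, Equiv.swap_apply_right] at hx hy
        exact ⟨hx, hy⟩
      · rintro ⟨hx, hy⟩
        funext z
        by_cases hzx : z = x
        · rw [hzx, Equiv.swap_apply_left]; exact hx
        · by_cases hzy : z = y
          · rw [hzy, Equiv.swap_apply_right]; exact hy
          · rw [Equiv.swap_apply_of_ne_of_ne hzx hzy]; exact (h z hzx hzy).symm
    have h2 : σ = τ ↔ (σ x = τ x ∧ σ y = τ y) := by
      constructor
      · intro hσ; rw [hσ]; exact ⟨rfl, rfl⟩
      · rintro ⟨hx, hy⟩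
        funext z
        by_cases hzx : z = x
        · rw [hzx]; exact hx
        · by_cases hzy : z = y
          · rw [hzy]; exact hy
          · exact h z hzx hzy
    rw [if_congr h1 rfl rfl, if_congr h2 rfl rfl]
    exact nidB1_fin_two_exchange (σ x) (σ y) (τ x) (τ y)
  · have h1 : ¬ (τ = fun z => σ (Equiv.swap x y z)) := by
      intro hτ
      apply h
      intro z hzx hzy
      have := congrFun hτ z
      rw [Equiv.swap_apply_of_ne_of_ne hzx hzy] at this
      exact this.symm
    have h2 : ¬ (σ = τ) := by
      intro hσ; apply h; intro z _ _; rw [hσ]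
    rw [if_neg h1, if_neg h, if_neg h2]
    norm_num

/-- The permutation unitary of the identity relabelling is the identity, `permOp 1 = 1`. [folklore] -/
theorem nidB1_permOp_refl {Λ : Type*} [Fintype Λ] [DecidableEq Λ] {q : ℕ} :
    (permOp (Equiv.refl Λ) : Op Λ q) = 1 := by
  ext σ τ
  rw [permOp_apply, Matrix.one_apply]
  simp only [Equiv.refl_apply]
  exact if_congr (Iff.intro (fun h => h.symm) (fun h => h.symm)) rfl rfl

/-- The on-site Casimir of a spin `½`: `𝐒_x·𝐒_x = ¾·1` (`S(S+1)` with `S = ½`). Tasaki (2020) §2.1,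
eq. (2.1.2); §2.2, eq. (2.2.7). [folklore] -/
theorem nidB1_spinDot_self {Λ : Type*} [Fintype Λ] [DecidableEq Λ] (x : Λ) :
    (spinDot 1 x x : Op Λ 2) = (3 / 4 : ℂ) • 1 := by
  have h : ∀ α : Fin 3, (spinBond 1 α x x : Op Λ 2) = siteSpin 1 x α * siteSpin 1 x α := by
    intro α
    rw [spinBond, ← two_smul ℂ (siteSpin 1 x α * siteSpin 1 x α : Op Λ 2), smul_smul]
    norm_num
  rw [spinDot, Finset.sum_congr rfl fun α _ => h α, sum_siteSpin_mul_siteSpin_holds 1 x]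
  norm_num

/-- The exchange identity for ALL pairs of sites: `T_xy + [x = y]·1 = 2 𝐒_x·𝐒_y + ½·1`
(for `x = y`: `T_xx = 1` and `𝐒_x·𝐒_x = ¾`). Dirac, *Principles* §58; Tasaki (2020) §2.1–2.2.
[folklore] -/
theorem nidB1_permOp_swap_add_ite {Λ : Type*} [Fintype Λ] [DecidableEq Λ] (x y : Λ) :
    (permOp (Equiv.swap x y) : Op Λ 2) + (if x = y then (1 : Op Λ 2) else 0) =
      (2 : ℂ) • spinDot 1 x y + (1 / 2 : ℂ) • 1 := by
  by_cases hxy : x = y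
  · subst hxy
    rw [if_pos rfl, Equiv.swap_self, nidB1_permOp_refl, nidB1_spinDot_self, smul_smul, ← add_smul,
      ← two_smul ℂ (1 : Op Λ 2)]
    congr 1
    norm_num
  · rw [if_neg hxy, add_zero, nidB1_permOp_swap_eq hxy]

/-! ### The total-spin Casimir as a sum of exchange operators -/

/-- `(𝐒_tot)² = Σ_x Σ_y 𝐒_x·𝐒_y` (ordered pairs, diagonal included; the symmetrised exchange
operator `spinDot` absorbs the symmetrisation of the double sum). Tasaki (2020) §2.2, eq. (2.2.13).
[folklore] -/
theorem nidB1_totalSpinSq_eq_sum_spinDot {Λ : Type*} [Fintype Λ] [DecidableEq Λ] (n : ℕ) :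
    (totalSpinSq n : Op Λ (n + 1)) = ∑ x, ∑ y, spinDot n x y := by
  have h : (totalSpinSq n : Op Λ (n + 1)) = ∑ x, ∑ y, ∑ α : Fin 3, siteSpin n x α * siteSpin n y α := by
    unfold totalSpinSq totalSpin
    simp only [Finset.sum_mul_sum]
    rw [Finset.sum_comm]
    refine Finset.sum_congr rfl fun x _ => ?_
    rw [Finset.sum_comm]
  have h' : (∑ x : Λ, ∑ y : Λ, ∑ α : Fin 3, (siteSpin n x α * siteSpin n y α : Op Λ (n + 1))) =
      ∑ x : Λ, ∑ y : Λ, ∑ α : Fin 3, (siteSpin n y α * siteSpin n x α : Op Λ (n + 1)) := by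
    rw [Finset.sum_comm]
  rw [h]
  unfold spinDot spinBond
  simp only [smul_add, Finset.sum_add_distrib, ← Finset.smul_sum]
  rw [← h', ← add_smul]
  norm_num

/-- **The exchange sum identity** for spin `½` on a finite set of sites `Λ`:
`Σ_x Σ_y T_xy + |Λ|·1 = 2(𝐒_tot)² + (|Λ|²/2)·1` (ordered pairs), i.e.
`(𝐒_tot)² = ½ Σ_{x,y} T_xy - |Λ|(|Λ| - 2)/4`. Dirac, *Principles* §58; Tasaki (2020) §2.2,
eq. (2.2.13). [folklore] -/
theorem nidB1_sum_permOp_swap {Λ : Type*} [Fintype Λ] [DecidableEq Λ] :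
    (∑ x : Λ, ∑ y : Λ, (permOp (Equiv.swap x y) : Op Λ 2)) + (Fintype.card Λ : ℂ) • 1 =
      (2 : ℂ) • totalSpinSq 1 + ((Fintype.card Λ : ℂ) ^ 2 / 2) • 1 := by
  have hdiag : (∑ x : Λ, ∑ y : Λ, (if x = y then (1 : Op Λ 2) else 0)) = (Fintype.card Λ : ℂ) • 1 := by
    simp only [Finset.sum_ite_eq, Finset.mem_univ, if_true, Finset.sum_const, Finset.card_univ]
    rw [← Nat.cast_smul_eq_nsmul ℂ]
  have hconst : (∑ _x : Λ, ∑ _y : Λ, ((1 / 2 : ℂ) • (1 : Op Λ 2))) = ((Fintype.card Λ : ℂ) ^ 2 / 2) • 1 := by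
    rw [Finset.sum_const, Finset.sum_const, Finset.card_univ, ← Nat.cast_smul_eq_nsmul ℂ,
      ← Nat.cast_smul_eq_nsmul ℂ, smul_smul, smul_smul]
    congr 1
    ring
  rw [← hdiag, ← Finset.sum_add_distrib]
  simp only [← Finset.sum_add_distrib, nidB1_permOp_swap_add_ite]
  rw [nidB1_totalSpinSq_eq_sum_spinDot, ← hconst]
  simp only [Finset.sum_add_distrib, Finset.smul_sum]

/-! ### The registered stub -/

/-- **Planar-deficit identity** (stub `stub_planarDeficit` of line `birth`, crux
`NearIsotropicDiluteBEC`). For a unit vector `ψ` of the spin-`½` system on the torus `(ℤ/Lℤ)³`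
(`V = L³` sites) in the magnetisation sector `S³_tot = N - V/2` (i.e. `N` up spins),
`Re⟨ψ, ((S¹_tot)² + (S²_tot)²)ψ⟩ + N - V/2 = N(V - N + 1) - ½ Σ_x Σ_y Re⟨ψ, (1 - T_xy)ψ⟩`, where
`T_xy = permOp (Equiv.swap x y)` transposes the spins at `x` and `y`. Proof: the exchange sum
identity `Σ_{x,y} T_xy + V = 2(𝐒_tot)² + V²/2` (Dirac `T_xy = 2𝐒_x·𝐒_y + ½`, spin-`½` Casimir `¾`),
`Q = (𝐒_tot)² - (S³_tot)²`, `⟨(S³_tot)²⟩_ψ = (N - V/2)²`, and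
`V²/4 + V/2 - (N - V/2)² + (N - V/2) = N(V - N + 1)`. The hypotheses `2 ≤ L`, `N ≤ L³` are not
needed. Dirac, *Principles of Quantum Mechanics* §58; Tasaki (2020) §2.2. [folklore] -/
theorem stub_planarDeficit :
    ∀ (L : ℕ) [NeZero L], 2 ≤ L → ∀ N : ℕ, N ≤ L ^ 3 → ∀ ψ : TensorIndex (TorusSite 3 L) 2 → ℂ, ((totalSpin 1 2 : Op (TorusSite 3 L) 2) + ((L : ℂ) ^ 3 / 2 - (N : ℂ)) • 1) *ᵥ ψ = 0 → star ψ ⬝ᵥ ψ = 1 → (star ψ ⬝ᵥ ((totalSpin 1 0 : Op (TorusSite 3 L) 2) * totalSpin 1 0 + totalSpin 1 1 * totalSpin 1 1) *ᵥ ψ).re + N - (L : ℝ) ^ 3 / 2 = (N : ℝ) * ((L : ℝ) ^ 3 - N + 1) - 1 / 2 * ∑ x : TorusSite 3 L, ∑ y : TorusSite 3 L, (star ψ ⬝ᵥ ((1 : Op (TorusSite 3 L) 2) - permOp (Equiv.swap x y)) *ᵥ ψ).re := by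
  intro L _ _hL N _hN ψ hQ hψ
  -- (1) the sector condition: `S³_tot ψ = M ψ` with `M = N - L³/2`, hence `⟨ψ, (S³_tot)² ψ⟩ = M²`
  have hS2 : (totalSpin 1 2 : Op (TorusSite 3 L) 2) *ᵥ ψ = ((N : ℂ) - (L : ℂ) ^ 3 / 2) • ψ := by
    have h := hQ
    rw [add_mulVec, smul_mulVec, one_mulVec, add_eq_zero_iff_eq_neg, ← neg_smul] at h
    rw [h]
    congr 1
    ring
  have hS22 : star ψ ⬝ᵥ ((totalSpin 1 2 : Op (TorusSite 3 L) 2) * totalSpin 1 2) *ᵥ ψ =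
      ((N : ℂ) - (L : ℂ) ^ 3 / 2) * ((N : ℂ) - (L : ℂ) ^ 3 / 2) := by
    rw [← mulVec_mulVec, hS2, mulVec_smul, hS2, smul_smul, dotProduct_smul, hψ, smul_eq_mul, mul_one]
  -- (2) the planar part of the Casimir: `(S¹)² + (S²)² = (𝐒_tot)² - (S³)²`
  have hplanar : ((totalSpin 1 0 : Op (TorusSite 3 L) 2) * totalSpin 1 0 + totalSpin 1 1 * totalSpin 1 1) =
      totalSpinSq 1 - totalSpin 1 2 * totalSpin 1 2 := by
    rw [totalSpinSq, Fin.sum_univ_three]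
    exact (add_sub_cancel_right _ _).symm
  -- (3) the expectation of the exchange sum identity `Σ_{x,y} T_xy + V = 2(𝐒_tot)² + V²/2`
  have hcard : (Fintype.card (TorusSite 3 L) : ℂ) = (L : ℂ) ^ 3 := by
    rw [Summit.AtomisticToContinuum.BoseEinsteinCondensation.Theorems.InsertionFieldDelocalisation.Negative.card_torusSite, Nat.cast_pow]
  have hexp := congrArg (fun A : Op (TorusSite 3 L) 2 => star ψ ⬝ᵥ A *ᵥ ψ)
    (nidB1_sum_permOp_swap (Λ := TorusSite 3 L))
  simp only [add_mulVec, smul_mulVec, one_mulVec, Matrix.sum_mulVec, dotProduct_add, dotProduct_smul,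
    dotProduct_sum, hψ, smul_eq_mul, mul_one, hcard] at hexp
  -- (4) `⟨ψ, T_xy ψ⟩ = 1 - ⟨ψ, (1 - T_xy)ψ⟩` and `Σ_{x,y} 1 = V²`
  have hT : ∀ x y : TorusSite 3 L, star ψ ⬝ᵥ (permOp (Equiv.swap x y) : Op (TorusSite 3 L) 2) *ᵥ ψ =
      1 - star ψ ⬝ᵥ ((1 : Op (TorusSite 3 L) 2) - permOp (Equiv.swap x y)) *ᵥ ψ := by
    intro x y
    rw [sub_mulVec, dotProduct_sub, one_mulVec, hψ, sub_sub_cancel]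
  simp only [hT, Finset.sum_sub_distrib, Finset.sum_const, Finset.card_univ,
    Summit.AtomisticToContinuum.BoseEinsteinCondensation.Theorems.InsertionFieldDelocalisation.Negative.card_torusSite,
    nsmul_eq_mul, Nat.cast_pow, mul_one] at hexp
  -- (5) assemble: `⟨ψ, Qψ⟩ = (V²/4 + V/2 - M²) - ½ Σ_{x,y} ⟨ψ, (1 - T_xy)ψ⟩`, then take real parts
  have key : star ψ ⬝ᵥ ((totalSpin 1 0 : Op (TorusSite 3 L) 2) * totalSpin 1 0 + totalSpin 1 1 * totalSpin 1 1) *ᵥ ψ =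
      (((L : ℝ) ^ 3 * (L : ℝ) ^ 3 / 4 + (L : ℝ) ^ 3 / 2 - ((N : ℝ) - (L : ℝ) ^ 3 / 2) * ((N : ℝ) - (L : ℝ) ^ 3 / 2) : ℝ) : ℂ) -
        ((1 / 2 : ℝ) : ℂ) * ∑ x : TorusSite 3 L, ∑ y : TorusSite 3 L,
          star ψ ⬝ᵥ ((1 : Op (TorusSite 3 L) 2) - permOp (Equiv.swap x y)) *ᵥ ψ := by
    rw [hplanar, sub_mulVec, dotProduct_sub, hS22]
    push_cast
    linear_combination (-1 / 2 : ℂ) * hexp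
  rw [key, Complex.sub_re, Complex.ofReal_re, Complex.re_ofReal_mul]
  simp only [Complex.re_sum]
  ring

end Summit.AtomisticToContinuum.BoseEinsteinCondensation.Cruxes.NearIsotropicDiluteBEC.Birth

end
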